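import Summits.QuantumFields.YangMills.Theorems.PoincareLipschitzStubBoundedBoxConcentration
import Summits.QuantumFields.YangMills.Theses.PoincareLipschitz
import HarnessLib

/-!
# K1′ `PoincareLipschitz.MesoscopicConcentrationL` (stmt-QuantumFields-23532) — THE ONE-ROW FACE: THE CRUX FOLLOWS FROM ITS MESOSCOPIC RESIDUAL ALONE

Cell `ym3-torus` (YM ladder rung R3 = continuum SU(2) Yang–Mills on T³ — a RUNG, NOT d = 4, NOT infinite volume, NOT a mass gap, NOT Clay).
Width seat `ym3-torus-px10` g8; `--supports stmt-QuantumFields-23532 --as helper`; theorems only, definition-free, default heartbeats.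

WHAT.  Route PoincareLipschitz's crux K1′ `MesoscopicConcentrationL` (a β-uniform Gaussian concentration inequality for gauge-invariant box-local
Λ-link-Lipschitz observables of the level-`K` unit-lattice Wilson law `gibbsK`, boxes of side `1 ≤ n ≤ β_K`) is split by LINE 23
(`Cruxes/HistoryTailL/Lines/poincare_lipschitz.lean`, ideator `ym-r3-idea-2`) by box side into
* the BOUNDED-BOX rung `n ≤ 17·L³` — a TREE THEOREM WITHOUT HYPOTHESES since 2026-08-29 04:24Z:
  ✓`Summit.QuantumFields.YangMills.Theorems.PoincareLipschitzStubBoundedBoxConcentration.stub_boundedBoxConcentration` (LEAD ★w1-19936 g8, the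
  registered text verbatim, `:=` ★w7-19936 g10's ✓p694602 `LocalInsertion.BoxConcentrationBounded.boxConcentration_bounded L (17·L³)`: comb/axial
  gauge on the box + the prefactor-free level-0 plaquette tail + union bound + centring); re-derived independently by LINE 29 «CombPeierls»
  (✓p739489 (P) · ✓p739571 (D) · ✓p739715 (B), 2026-08-29 19:05–19:11Z);
* the MESOSCOPIC RESIDUAL `17·L³ < n ≤ β_K` — LINE 23's hardest stub `stub_mesoscopicBoxConcentration` (= LINE 29's (R), same registered text on
  stmt-QuantumFields-23532): XL, organ-adjacent (a β-uniform functional inequality at weak coupling up to the confinement scale), NOT proved anywhere.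

THIS FILE records, by kernel and in the Theorems tree (the skeletons' compositions live under `Cruxes/` and are not importable), that the crux BY NAME
now rests on the residual ONLY:
* `mesoscopicConcentrationL_of (hbdd) (hR)` — the two ranges ⟹ the crux TEXT (max/min of the constant packages);
* ★★★ `mesoscopicConcentrationL_of_mesoscopicBox (hR) : Summit.QuantumFields.YangMills.Theses.PoincareLipschitz.MesoscopicConcentrationL` — ONE displayed
  hypothesis, the residual verbatim.

HONEST SCOPE.  A display/bookkeeping theorem (elementary real arithmetic over a landed theorem).  It proves NOTHING of the residual — which is the whole
content of K1 —, nothing of `HistoryTailL` (19936), `MeanDeviationL` (23083), `BlockLipschitzL`'s siblings, EX (19200), 20520, any rung or summit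
statement.  Sorry-free, axioms standard.

References: T. Bałaban, Commun. Math. Phys. **102** (1985) 255–275 [Balaban1985UV3] ((3) p.256, (7) p.257: the unit-lattice action and Gibbs law).
-/

open scoped BigOperators
open MeasureTheory
open Literature.MathematicalPhysics.QuantumFieldTheory.Balaban1983to89
open Literature.MathematicalPhysics.QuantumFieldTheory.Balaban1983to89.T3ContinuumYM3Torus
open Literature.MathematicalPhysics.QuantumFieldTheory.Balaban1983to89.T3UnitScaleTilt
open Literature.MathematicalPhysics.QuantumFieldTheory.Balaban1983to89.T3UnitLawDensityEML (ℰp)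

namespace Summit.QuantumFields.YangMills.Theorems.PoincareLipschitzMesoscopicConcentrationLOfMesoscopicBox

/-- GLUE (both box ranges ⟹ the TEXT of `MesoscopicConcentrationL`, verbatim signature of stmt-QuantumFields-23532): max/min of the two constant
packages and monotonicity of `(C, c) ↦ C·e^{−c·x}`.  Port of the kernel-checked composition `MesoscopicConcentrationL_of` of LINE 23's skeleton
`Cruxes/HistoryTailL/Lines/poincare_lipschitz.lean` (= §4 `mesoscopicConcentrationL_of` of LINE 29's `comb_peierls.lean`), hypotheses displayed.
The crux BY NAME is concluded by `mesoscopicConcentrationL_of_mesoscopicBox` below. -/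
theorem mesoscopicConcentrationL_of
    (hbdd :
    open Literature.MathematicalPhysics.QuantumFieldTheory.Balaban1983to89 Literature.MathematicalPhysics.QuantumFieldTheory.Balaban1983to89.T3ContinuumYM3Torus in ∀ (L : ℕ), ∃ (Cc cc : ℝ), 0 ≤ Cc ∧ 0 < cc ∧ ∃ γ₁ : ℝ, 0 < γ₁ ∧ γ₁ ≤ 1 ∧ ∀ (F : T3Family) (γ : ℝ), F.L = L → 0 < γ → γ ≤ γ₁ → ∀ (K n : ℕ), 1 ≤ n → (n : ℝ) ≤ (F.scheme T3UnitLawDensityEML.ℰp γ).β K → 2 * n ≤ (F.P K).sitesPerDir 0 → n ≤ 17 * L ^ 3 → ∀ (x₀ : Site (F.P K) 0) (f : GaugeField (F.P K) 0 (Matrix.specialUnitaryGroup (Fin 2) ℂ) → ℝ) (Λ : ℝ), 0 < Λ → Measurable f → GaugeField.GaugeInvariant f → (∀ U U' : GaugeField (F.P K) 0 (Matrix.specialUnitaryGroup (Fin 2) ℂ), (∀ b : PBond (F.P K) 0, (∀ k, (b.src k - x₀ k).val < n) → (∀ k, (b.tgt k - x₀ k).val < n) → U b = U' b) → f U = f U')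 → (∀ U U' : GaugeField (F.P K) 0 (Matrix.specialUnitaryGroup (Fin 2) ℂ), |f U - f U'| ≤ Λ * Real.sqrt (∑ b : PBond (F.P K) 0, GaugeGroup.dist1 (U b * (U' b)⁻¹) ^ 2)) → ∀ r : ℝ, 0 ≤ r → (T3UnitScaleTilt.gibbsK F T3UnitLawDensityEML.ℰp γ K).real {U | r ≤ f U - ∫ V, f V ∂(T3UnitScaleTilt.gibbsK F T3UnitLawDensityEML.ℰp γ K)} ≤ Cc * Real.exp (-(cc * (F.scheme T3UnitLawDensityEML.ℰp γ).β K * r ^ 2 / ((n : ℝ) ^ 2 * Λ ^ 2))))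
    (hR : open Literature.MathematicalPhysics.QuantumFieldTheory.Balaban1983to89 Literature.MathematicalPhysics.QuantumFieldTheory.Balaban1983to89.T3ContinuumYM3Torus in ∀ (L : ℕ), ∃ (Cc cc : ℝ), 0 ≤ Cc ∧ 0 < cc ∧ ∃ γ₁ : ℝ, 0 < γ₁ ∧ γ₁ ≤ 1 ∧ ∀ (F : T3Family) (γ : ℝ), F.L = L → 0 < γ → γ ≤ γ₁ → ∀ (K n : ℕ), 1 ≤ n → (n : ℝ) ≤ (F.scheme T3UnitLawDensityEML.ℰp γ).β K → 2 * n ≤ (F.P K).sitesPerDir 0 → 17 * L ^ 3 < n → ∀ (x₀ : Site (F.P K) 0) (f : GaugeField (F.P K) 0 (Matrix.specialUnitaryGroup (Fin 2) ℂ) → ℝ) (Λ : ℝ), 0 < Λ → Measurable f → GaugeField.GaugeInvariant f → (∀ U U' : GaugeField (F.P K) 0 (Matrix.specialUnitaryGroup (Fin 2) ℂ), (∀ b : PBond (F.P K) 0, (∀ k, (b.src k - x₀ k).val < n) → (∀ k, (b.tgt k - x₀ k).val < n) → U b = U' b) → f U = f U') → (∀ U U' : GaugeField (F.P K) 0 (Matrix.specialUnitaryGroup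 (Fin 2) ℂ), |f U - f U'| ≤ Λ * Real.sqrt (∑ b : PBond (F.P K) 0, GaugeGroup.dist1 (U b * (U' b)⁻¹) ^ 2)) → ∀ r : ℝ, 0 ≤ r → (T3UnitScaleTilt.gibbsK F T3UnitLawDensityEML.ℰp γ K).real {U | r ≤ f U - ∫ V, f V ∂(T3UnitScaleTilt.gibbsK F T3UnitLawDensityEML.ℰp γ K)} ≤ Cc * Real.exp (-(cc * (F.scheme T3UnitLawDensityEML.ℰp γ).β K * r ^ 2 / ((n : ℝ) ^ 2 * Λ ^ 2)))) :
    open Literature.MathematicalPhysics.QuantumFieldTheory.Balaban1983to89 Literature.MathematicalPhysics.QuantumFieldTheory.Balaban1983to89.T3ContinuumYM3Torus in ∀ (L : ℕ), ∃ (Cc cc : ℝ), 0 ≤ Cc ∧ 0 < cc ∧ ∃ γ₁ : ℝ, 0 < γ₁ ∧ γ₁ ≤ 1 ∧ ∀ (F : T3Family) (γ : ℝ), F.L = L → 0 < γ → γ ≤ γ₁ → ∀ (K n : ℕ), 1 ≤ n → (n : ℝ) ≤ (F.scheme T3UnitLawDensityEML.ℰp γ).β K → 2 * n ≤ (F.P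 K).sitesPerDir 0 → ∀ (x₀ : Site (F.P K) 0) (f : GaugeField (F.P K) 0 (Matrix.specialUnitaryGroup (Fin 2) ℂ) → ℝ) (Λ : ℝ), 0 < Λ → Measurable f → GaugeField.GaugeInvariant f → (∀ U U' : GaugeField (F.P K) 0 (Matrix.specialUnitaryGroup (Fin 2) ℂ), (∀ b : PBond (F.P K) 0, (∀ k, (b.src k - x₀ k).val < n) → (∀ k, (b.tgt k - x₀ k).val < n) → U b = U' b) → f U = f U') → (∀ U U' : GaugeField (F.P K) 0 (Matrix.specialUnitaryGroup (Fin 2) ℂ), |f U - f U'| ≤ Λ * Real.sqrt (∑ b : PBond (F.P K) 0, GaugeGroup.dist1 (U b * (U' b)⁻¹) ^ 2)) → ∀ r : ℝ, 0 ≤ r → (T3UnitScaleTilt.gibbsK F T3UnitLawDensityEML.ℰp γ K).real {U | r ≤ f U - ∫ V, f V ∂(T3UnitScaleTilt.gibbsK F T3UnitLawDensityEML.ℰp γ K)} ≤ Cc * Real.exp (-(cc * (F.scheme T3UnitLawDensityEML.ℰp γ).β K * r ^ 2 / ((n : ℝ) ^ 2 * Λ ^ 2))) := by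
  intro L
  obtain ⟨Cc₁, cc₁, hCc₁, hcc₁, γa, hγa, hγa1, H1⟩ := hbdd L
  obtain ⟨Cc₂, cc₂, hCc₂, hcc₂, γb, hγb, hγb1, H2⟩ := hR L
  refine ⟨max Cc₁ Cc₂, min cc₁ cc₂, le_max_of_le_left hCc₁, lt_min hcc₁ hcc₂, min γa γb, lt_min hγa hγb,
    (min_le_left _ _).trans hγa1, ?_⟩
  intro F γ hFL hγ hγle K n hn1 hnβ h2n x₀ f Λ hΛ hfm hfG hloc hlip r hr
  have hn1r : (1 : ℝ) ≤ (n : ℝ) := by exact_mod_cast hn1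
  have hβ0 : (0 : ℝ) ≤ (F.scheme ℰp γ).β K := by linarith [hn1r.trans hnβ]
  have hQ0 : 0 ≤ (F.scheme ℰp γ).β K * r ^ 2 / ((n : ℝ) ^ 2 * Λ ^ 2) := by positivity
  -- monotonicity in the constants
  have hmono : ∀ (C c : ℝ), C ≤ max Cc₁ Cc₂ → min cc₁ cc₂ ≤ c →
      C * Real.exp (-(c * (F.scheme ℰp γ).β K * r ^ 2 / ((n : ℝ) ^ 2 * Λ ^ 2)))
        ≤ max Cc₁ Cc₂ * Real.exp (-(min cc₁ cc₂ * (F.scheme ℰp γ).β K * r ^ 2 / ((n : ℝ) ^ 2 * Λ ^ 2))) := by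
    intro C c hC hc
    refine mul_le_mul hC ?_ (Real.exp_pos _).le ((hCc₁.trans (le_max_left _ _)))
    rw [Real.exp_le_exp, neg_le_neg_iff]
    have e1 : min cc₁ cc₂ * (F.scheme ℰp γ).β K * r ^ 2 / ((n : ℝ) ^ 2 * Λ ^ 2)
        = min cc₁ cc₂ * ((F.scheme ℰp γ).β K * r ^ 2 / ((n : ℝ) ^ 2 * Λ ^ 2)) := by ring
    have e2 : c * (F.scheme ℰp γ).β K * r ^ 2 / ((n : ℝ) ^ 2 * Λ ^ 2)
        = c * ((F.scheme ℰp γ).β K * r ^ 2 / ((n : ℝ) ^ 2 * Λ ^ 2)) := by ring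
    rw [e1, e2]
    exact mul_le_mul_of_nonneg_right hc hQ0
  by_cases hnL : n ≤ 17 * L ^ 3
  · exact (H1 F γ hFL hγ (hγle.trans (min_le_left _ _)) K n hn1 hnβ h2n hnL x₀ f Λ hΛ hfm hfG hloc hlip r hr).trans
      (hmono Cc₁ cc₁ (le_max_left _ _) (min_le_left _ _))
  · exact (H2 F γ hFL hγ (hγle.trans (min_le_right _ _)) K n hn1 hnβ h2n (not_le.mp hnL) x₀ f Λ hΛ hfm hfG hloc hlip r hr).trans
      (hmono Cc₂ cc₂ (le_max_right _ _) (min_le_right _ _))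


/-- ★★★ **THE ONE-ROW K1 FACE.**  `PoincareLipschitz.MesoscopicConcentrationL` (stmt-QuantumFields-23532) BY NAME follows from the mesoscopic
residual ALONE — LINE 23's hardest stub `stub_mesoscopicBoxConcentration` (boxes `17·L³ < n ≤ β_K`), displayed VERBATIM as the hypothesis `hR`
(registered text, 1173 chars; organ-adjacent, NOT proved anywhere) — the bounded-box rung `n ≤ 17·L³` being the hypothesis-free tree theorem
✓`PoincareLipschitzStubBoundedBoxConcentration.stub_boundedBoxConcentration` (LEAD ★w1-19936 g8 over ★w7-19936 g10's ✓p694602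
`LocalInsertion.BoxConcentrationBounded.boxConcentration_bounded`).  [cite: Balaban1985UV3, (3) p.256, (7) p.257 — the unit-lattice law `gibbsK`] -/
theorem mesoscopicConcentrationL_of_mesoscopicBox
    (hR : open Literature.MathematicalPhysics.QuantumFieldTheory.Balaban1983to89 Literature.MathematicalPhysics.QuantumFieldTheory.Balaban1983to89.T3ContinuumYM3Torus in ∀ (L : ℕ), ∃ (Cc cc : ℝ), 0 ≤ Cc ∧ 0 < cc ∧ ∃ γ₁ : ℝ, 0 < γ₁ ∧ γ₁ ≤ 1 ∧ ∀ (F : T3Family) (γ : ℝ), F.L = L → 0 < γ → γ ≤ γ₁ → ∀ (K n : ℕ), 1 ≤ n → (n : ℝ) ≤ (F.scheme T3UnitLawDensityEML.ℰp γ).β K → 2 * n ≤ (F.P K).sitesPerDir 0 → 17 * L ^ 3 < n → ∀ (x₀ : Site (F.P K) 0) (f : GaugeField (F.P K) 0 (Matrix.specialUnitaryGroup (Fin 2) ℂ) → ℝ) (Λ : ℝ), 0 < Λ → Measurable f → GaugeField.GaugeInvariant f → (∀ U U' : GaugeField (F.P K) 0 (Matrix.specialUnitaryGroup (Fin 2)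 ℂ), (∀ b : PBond (F.P K) 0, (∀ k, (b.src k - x₀ k).val < n) → (∀ k, (b.tgt k - x₀ k).val < n) → U b = U' b) → f U = f U') → (∀ U U' : GaugeField (F.P K) 0 (Matrix.specialUnitaryGroup (Fin 2) ℂ), |f U - f U'| ≤ Λ * Real.sqrt (∑ b : PBond (F.P K) 0, GaugeGroup.dist1 (U b * (U' b)⁻¹) ^ 2)) → ∀ r : ℝ, 0 ≤ r → (T3UnitScaleTilt.gibbsK F T3UnitLawDensityEML.ℰp γ K).real {U | r ≤ f U - ∫ V, f V ∂(T3UnitScaleTilt.gibbsK F T3UnitLawDensityEML.ℰp γ K)} ≤ Cc * Real.exp (-(cc * (F.scheme T3UnitLawDensityEML.ℰp γ).β K * r ^ 2 / ((n : ℝ) ^ 2 * Λ ^ 2)))) :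
    Summit.QuantumFields.YangMills.Theses.PoincareLipschitz.MesoscopicConcentrationL := by
  have h := mesoscopicConcentrationL_of
    Summit.QuantumFields.YangMills.Theorems.PoincareLipschitzStubBoundedBoxConcentration.stub_boundedBoxConcentration hR
  exact h

end Summit.QuantumFields.YangMills.Theorems.PoincareLipschitzMesoscopicConcentrationLOfMesoscopicBox
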